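import Mathlib.RingTheory.MvPolynomial.MonomialOrder
import Mathlib.Algebra.Order.Chebyshev
import Literature.Computability.AlgebraicComplexity.ProjectedShiftedPartials
import HarnessLib

/-!
# Lower-bound tools for projected shifted partial derivatives (Kumar–Saraf 2017, §3, §5)

Topic `Literature/Computability/AlgebraicComplexity`; infrastructure for the printed proof of
`kumarSaraf2017_imm_homDepthFour` (`HomogeneousDepthFour.lean`), the generic part of the LOWER
bound for the measure `Φ_{ℳ,m}` (`KumarSaraf.pspDim`, `ProjectedShiftedPartials.lean`):

* `linearIndependent_of_triangular'` — Gaussian elimination with pivots ordered in an arbitrary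
  linear order (the tree's `GKKS.linearIndependent_of_triangular` has heights in `ℕ`).
* **[KS, Lemma 5.1, engine]** `card_le_finrank_of_leading`: "for any linear space of polynomials,
  its dimension is at least the number of distinct leading monomials in the space" — for a
  monomial order `mo` (Mathlib's `MonomialOrder`, e.g. `MonomialOrder.lex`), a finite set of
  exponent vectors each of which is the leading monomial `mo.degree` of a non-zero member of `W` has
  at most `finrank W` elements.
* The sets of [KS, §5]: `sSet m β` = `S_m(α, β)`, the sets `γ` of `m` variables disjoint from
  `β` (as sets of variables; `x^γ` is the multilinear shift), with `card_sSet`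
  (`= C(N - |supp β|, m)`, the count behind Lemma 8.3) and `sSet_inter` / `card_sSet_inter`
  (`|S_m(α,β) ∩ S_m(α,γ)| = C(N - |supp β ∪ supp γ|, m)`, behind `T₂`); `aSet mo g m β` =
  `A_m(α, β)` for `g = ∂_α P`: the monomials `x^γ · x^β`, `γ ∈ S_m(α,β)`, that are the leading
  monomial of `σ(x^γ · g)`.
* **[KS, Lemma 5.1]** `card_biUnion_aSet_le_pspDim`:
  `Φ_{ℳ,m}(f) ≥ |⋃_{α ∈ ℳ, β} A_m(α, β)|`.
* **[KS, Lemma 5.3]** `card_biUnion_sSet_le_sum_card_aSet`: for `g` with multilinear monomials,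
  `∑_{β ∈ supp g} |A_m(α,β)| ≥ |⋃_{β ∈ supp g} S_m(α,β)|` (the injection `γ ↦ (β', γβ')`, `γβ'` the
  leading monomial of `σ(x^γ g)`).
* **[KS, Cor. 5.2 and Lemma 3.8]** for finite families of finite sets, by double counting the
  multiplicities `d(u) = #{i : u ∈ W_i}`: `sum_card_le_card_biUnion_add`
  (`∑|W_i| ≤ |⋃ W_i| + ∑_{i ≠ j} |W_i ∩ W_j|`, inclusion–exclusion truncated at order two) and
  `sq_sum_card_le` (`(∑|W_i|)² ≤ |⋃ W_i| · (∑|W_i| + ∑_{i≠j}|W_i ∩ W_j|)`, Cauchy–Schwarz), whence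
  the printed "strong inclusion–exclusion" `|⋃ W_i| ≥ (∑|W_i|)/(λ + 1) ≥ (∑|W_i|)/(4λ)` whenever
  `∑_{i≠j}|W_i ∩ W_j| ≤ λ ∑|W_i|` (`card_biUnion_ge_of_sum_inter_le`).

Everything is proved (D-0026: no named facts).

## References

* M. Kumar, S. Saraf, *On the power of homogeneous depth 4 arithmetic circuits*, SIAM J. Comput.
  46 (2017) 336–387 (arXiv:1404.1950): Lemma 3.8, §5 (Lemma 5.1, Cor. 5.2, Lemma 5.3), §8.5.
-/

noncomputable section

open MvPolynomial

namespace Literature.Computability.AlgebraicComplexity.KumarSaraf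

open GKKS

variable {K : Type*} [Field K] {σ : Type*}

/-! ### Leading monomials and dimension (KS, Lemma 5.1) -/

section Leading

/-- **Triangular criterion for linear independence**, pivots ordered in a linear order: if each
`v_i` has a functional `φ_i` with `φ_i(v_i) ≠ 0` and `φ_i(v_j) = 0` for `j ≠ i` of height `≤`
that of `i`, the family is linearly independent (Gaussian elimination). [folklore] -/
theorem linearIndependent_of_triangular' {F V ι α : Type*} [Field F] [AddCommGroup V] [Module F V]
    [LinearOrder α] (v : ι → V) (φ : ι → V →ₗ[F] F) (ht : ι → α) (h1 : ∀ i, φ i (v i) ≠ 0)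
    (h2 : ∀ i j, i ≠ j → ht j ≤ ht i → φ i (v j) = 0) : LinearIndependent F v := by
  classical
  rw [linearIndependent_iff']
  intro s g hg
  by_contra hne
  push Not at hne
  obtain ⟨i0, hi0s, hi0⟩ := hne
  obtain ⟨i, hiT, hmax⟩ := Finset.exists_max_image (s.filter fun i => g i ≠ 0) ht
    ⟨i0, Finset.mem_filter.2 ⟨hi0s, hi0⟩⟩
  rw [Finset.mem_filter] at hiT
  have key := congrArg (φ i) hg
  rw [map_sum, map_zero, Finset.sum_eq_single i] at key
  · rw [map_smul, smul_eq_mul] at key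
    exact hiT.2 ((mul_eq_zero.1 key).resolve_right (h1 i))
  · intro j hjs hji
    rw [map_smul, smul_eq_mul]
    by_cases hgj : g j = 0
    · rw [hgj, zero_mul]
    · rw [h2 i j (Ne.symm hji) (hmax j (Finset.mem_filter.2 ⟨hjs, hgj⟩)), mul_zero]
  · intro hi; exact absurd hiT.1 hi

/-- **Kumar–Saraf 2017, Lemma 5.1 (engine): "for any linear space of polynomials, its dimension
is at least the number of distinct leading monomials in the space."** For a monomial order `mo`
and a finite-dimensional space `W` of polynomials, a finite set of exponent vectors each of which
is the leading monomial of some non-zero member of `W` has at most `dim W` elements (the members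
are linearly independent by the triangular criterion on leading coefficients).
[cite: KumarSaraf2017, Lemma 5.1] -/
theorem card_le_finrank_of_leading (mo : MonomialOrder σ) {W : Submodule K (MvPolynomial σ K)}
    [Module.Finite K W] (A : Finset (σ →₀ ℕ))
    (hA : ∀ a ∈ A, ∃ f ∈ W, f ≠ 0 ∧ mo.degree f = a) : A.card ≤ Module.finrank K W := by
  classical
  choose! g hgW hg0 hgd using hA
  let v : A → W := fun a => ⟨g a, hgW a a.2⟩
  have hli : LinearIndependent K v := by
    refine linearIndependent_of_triangular' v
      (fun a => (lcoeff K (a : σ →₀ ℕ)).comp W.subtype) (fun a => mo.toSyn (a : σ →₀ ℕ))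
      (fun a => ?_) (fun a b hab hle => ?_)
    · simp only [LinearMap.comp_apply, Submodule.subtype_apply, lcoeff_apply, v]
      have h := mo.coeff_degree_ne_zero_iff.2 (hg0 a a.2)
      rwa [hgd a a.2] at h
    · simp only [LinearMap.comp_apply, Submodule.subtype_apply, lcoeff_apply, v]
      refine mo.coeff_eq_zero_of_lt ?_
      rw [hgd b b.2]
      refine lt_of_le_of_ne hle fun h => hab ?_
      exact Subtype.ext (mo.toSyn.injective h).symm
  have h := hli.fintype_card_le_finrank
  rwa [Fintype.card_coe] at h

end Leading

/-! ### The sets `S_m(α, β)` and `A_m(α, β)` (KS, §5) -/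

section Sets

variable [Fintype σ] [DecidableEq σ]

/-- **`S_m(α, β)`** (Kumar–Saraf 2017, §5): the multilinear monomials `x^γ` of degree `m`
disjoint from `β`, as sets `γ` of `m` variables disjoint from `supp β` (independent of `α`).
[cite: KumarSaraf2017, §5] -/
def sSet (m : ℕ) (β : σ →₀ ℕ) : Finset (Finset σ) :=
  Finset.powersetCard m (Finset.univ \ β.support)

/-- Membership in `S_m(α, β)`. [cite: KumarSaraf2017, §5] -/
theorem mem_sSet {m : ℕ} {β : σ →₀ ℕ} {γ : Finset σ} :
    γ ∈ sSet m β ↔ γ.card = m ∧ Disjoint γ β.support := by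
  rw [sSet, Finset.mem_powersetCard, Finset.subset_sdiff, and_comm]
  simp

/-- **`|S_m(α, β)| = C(N - |supp β|, m)`** — "the set of all multilinear monomials of degree
`m` which are disjoint from `β`" (the count `C(N-k, m)` of Lemma 8.3). [cite: KumarSaraf2017, §8.5] -/
theorem card_sSet (m : ℕ) (β : σ →₀ ℕ) :
    (sSet m β).card = (Fintype.card σ - β.support.card).choose m := by
  rw [sSet, Finset.card_powersetCard, Finset.card_univ_sdiff]

/-- `S_m(α, β) ∩ S_m(α, γ)`: the sets of `m` variables disjoint from both.
[cite: KumarSaraf2017, §8.5] -/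
theorem sSet_inter (m : ℕ) (β γ : σ →₀ ℕ) :
    sSet m β ∩ sSet m γ = Finset.powersetCard m (Finset.univ \ (β.support ∪ γ.support)) := by
  ext τ
  rw [Finset.mem_inter, mem_sSet, mem_sSet, Finset.mem_powersetCard, Finset.subset_sdiff,
    Finset.disjoint_union_right]
  constructor
  · rintro ⟨⟨h1, h2⟩, -, h3⟩
    exact ⟨⟨Finset.subset_univ _, h2, h3⟩, h1⟩
  · rintro ⟨⟨-, h2, h3⟩, h1⟩
    exact ⟨⟨h1, h2⟩, h1, h3⟩

/-- **`|S_m(α, β) ∩ S_m(α, γ)| = C(N - |supp β ∪ supp γ|, m)`** — "the number of multilinear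
monomials of degree `m` which are disjoint from both `β` and `γ`" (`= C(N - k - Δ(β,γ), m)` for
`|β| = |γ| = k` at distance `Δ`, the count behind `T₂`). [cite: KumarSaraf2017, §8.5] -/
theorem card_sSet_inter (m : ℕ) (β γ : σ →₀ ℕ) :
    (sSet m β ∩ sSet m γ).card = (Fintype.card σ - (β.support ∪ γ.support).card).choose m := by
  rw [sSet_inter, Finset.card_powersetCard, Finset.card_univ_sdiff]

variable (K)

open Classical in
/-- **`A_m(α, β)`** (Kumar–Saraf 2017, §5) for `g = ∂_α(P)` and `β ∈ supp g`: the monomials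
`x^γ · x^β` for those `γ ∈ S_m(α, β)` such that `x^γ x^β` is the leading monomial (for the monomial
order `mo`) of `σ(x^γ · g)` (classical decidability of the defining condition).
[cite: KumarSaraf2017, §5] -/
def aSet (mo : MonomialOrder σ) (g : MvPolynomial σ K) (m : ℕ) (β : σ →₀ ℕ) : Finset (σ →₀ ℕ) :=
  ((sSet m β).filter fun γ => mlProj K (monomial (chi γ) (1 : K) * g) ≠ 0 ∧
      mo.degree (mlProj K (monomial (chi γ) (1 : K) * g)) = chi γ + β).image fun γ => chi γ + β

variable {K}

/-- Membership in `A_m(α, β)`. [cite: KumarSaraf2017, §5] -/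
theorem mem_aSet {mo : MonomialOrder σ} {g : MvPolynomial σ K} {m : ℕ} {β δ : σ →₀ ℕ} :
    δ ∈ aSet K mo g m β ↔ ∃ γ ∈ sSet m β, mlProj K (monomial (chi γ) (1 : K) * g) ≠ 0 ∧
      mo.degree (mlProj K (monomial (chi γ) (1 : K) * g)) = chi γ + β ∧ δ = chi γ + β := by
  classical
  unfold aSet
  rw [Finset.mem_image]
  constructor
  · rintro ⟨γ, hγ, rfl⟩
    rw [Finset.mem_filter] at hγ
    exact ⟨γ, hγ.1, hγ.2.1, hγ.2.2, rfl⟩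
  · rintro ⟨γ, hγ, h1, h2, rfl⟩
    exact ⟨γ, Finset.mem_filter.2 ⟨hγ, h1, h2⟩, rfl⟩

/-- `A_m(α, β)` has at most `|S_m(α, β)|` elements. [cite: KumarSaraf2017, §5] -/
theorem card_aSet_le (mo : MonomialOrder σ) (g : MvPolynomial σ K) (m : ℕ) (β : σ →₀ ℕ) :
    (aSet K mo g m β).card ≤ (sSet m β).card := by
  classical
  unfold aSet
  exact Finset.card_image_le.trans (Finset.card_filter_le _ _)

/-- **Kumar–Saraf 2017, Lemma 5.1**: `Φ_{ℳ,m}(f) ≥ |⋃_{α ∈ ℳ, β} A_m(α, β)|` — every element of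
`A_m(α, β)` (for `g = ∂_α f`, `α = Ls i`) is the leading monomial of the non-zero member
`σ(x^γ · ∂_α f)` of the space of projected shifted partials. (`B i` is any finite set of `β`'s,
e.g. `supp ∂_α f`.) [cite: KumarSaraf2017, Lemma 5.1] -/
theorem card_biUnion_aSet_le_pspDim {ι : Type*} [Fintype ι] [DecidableEq ι] (mo : MonomialOrder σ)
    (Ls : ι → List σ) (m : ℕ) (f : MvPolynomial σ K) (I : Finset ι) (B : ι → Finset (σ →₀ ℕ)) :
    (I.biUnion fun i => (B i).biUnion fun β => aSet K mo (iterPderiv (Ls i) f) m β).card ≤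
      pspDim Ls m f := by
  refine card_le_finrank_of_leading mo _ fun a ha => ?_
  simp only [Finset.mem_biUnion] at ha
  obtain ⟨i, -, β, -, hβ⟩ := ha
  obtain ⟨γ, hγ, h1, h2, rfl⟩ := mem_aSet.1 hβ
  refine ⟨_, ?_, h1, h2⟩
  exact pspGen_mem Ls m f ⟨i, ⟨γ, (mem_sSet.1 hγ).1⟩⟩

/-- **Kumar–Saraf 2017, Lemma 5.3**: if every monomial of `g` (`= ∂_α P`) is multilinear, then
`∑_{β ∈ supp g} |A_m(α, β)| ≥ |⋃_{β ∈ supp g} S_m(α, β)|`. The map `γ ↦ (β', x^γ x^{β'})`, where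
`x^γ x^{β'}` is the leading monomial of `σ(x^γ · g)` (non-zero since `x^γ x^β` survives the
projection when `γ ∈ S_m(α, β)`; its leading monomial is `x^γ x^{β'}` for some `β' ∈ supp g`
disjoint from `γ`), is one-to-one. [cite: KumarSaraf2017, Lemma 5.3] -/
theorem card_biUnion_sSet_le_sum_card_aSet (mo : MonomialOrder σ) (g : MvPolynomial σ K)
    (hg : ∀ β ∈ g.support, IsML β) (m : ℕ) :
    (g.support.biUnion (sSet m)).card ≤ ∑ β ∈ g.support, (aSet K mo g m β).card := by
  classical
  rw [← Finset.card_sigma]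
  -- the leading `β'` of `σ(x^γ g)`
  set h : Finset σ → MvPolynomial σ K := fun γ => mlProj K (monomial (chi γ) (1 : K) * g) with hh
  set lead : Finset σ → (σ →₀ ℕ) := fun γ => mo.degree (h γ) - chi γ with hlead
  refine Finset.card_le_card_of_injOn (fun γ => ⟨lead γ, chi γ + lead γ⟩) (fun γ hγ => ?_)
    (fun γ₁ _ γ₂ _ heq => ?_)
  · -- well-defined: `γ ∈ S_m(α, β)` for some `β ∈ supp g`
    rw [Finset.coe_biUnion, Set.mem_iUnion₂] at hγ
    obtain ⟨β, hβ, hγβ⟩ := hγ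
    rw [Finset.mem_coe] at hβ hγβ
    obtain ⟨hcard, hdisj⟩ := mem_sSet.1 hγβ
    -- `x^γ x^β` survives the projection, so `h γ ≠ 0`
    have hne : h γ ≠ 0 := by
      intro h0
      have hc : coeff (chi γ + β) (h γ) = coeff β g := by
        simp only [hh, coeff_mlProj]
        rw [if_pos, coeff_monomial_mul', if_pos (self_le_add_right _ _), one_mul,
          add_tsub_cancel_left]
        -- `chi γ + β` is multilinear
        intro v
        rw [Finsupp.add_apply, chi_apply]
        split_ifs with hv
        · have : v ∉ β.support := Finset.disjoint_left.1 hdisj hv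
          rw [Finsupp.notMem_support_iff.1 this]
          exact le_rfl
        · rw [zero_add]; exact hg β hβ v
      rw [h0, coeff_zero] at hc
      exact (mem_support_iff.1 hβ) hc.symm
    -- its leading monomial `δ` is multilinear and lies above `chi γ`
    set δ := mo.degree (h γ) with hδ
    have hδsupp : δ ∈ (h γ).support := mo.degree_mem_support_iff _ |>.2 hne
    obtain ⟨hδML, hδg⟩ := mem_support_mlProj.1 hδsupp
    rw [mem_support_iff, coeff_monomial_mul'] at hδg
    split_ifs at hδg with hle
    · rw [one_mul] at hδg
      have hβ' : δ - chi γ ∈ g.support := mem_support_iff.2 hδg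
      have hδeq : chi γ + (δ - chi γ) = δ := add_tsub_cancel_of_le hle
      -- `β' = δ - chi γ` is disjoint from `γ`
      have hdisj' : Disjoint γ (δ - chi γ).support := by
        rw [Finset.disjoint_left]
        intro v hv hv'
        rw [Finsupp.mem_support_iff, Finsupp.tsub_apply, chi_apply, if_pos hv] at hv'
        have := hδML v
        omega
      refine Finset.mem_sigma.2 ⟨hβ', mem_aSet.2 ⟨γ, mem_sSet.2 ⟨hcard, hdisj'⟩, hne, ?_, rfl⟩⟩
      simp only [hlead]
      exact hδeq.symm
    · exact absurd rfl hδg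
  · -- injective: `γ` is recovered from `(β', chi γ + β')`
    simp only [Sigma.mk.injEq] at heq
    obtain ⟨h1, h2⟩ := heq
    have h3 : chi γ₁ = chi γ₂ := by
      have := eq_of_heq h2
      rw [h1] at this
      exact add_right_cancel this
    rw [← support_chi γ₁, ← support_chi γ₂, h3]

end Sets

/-! ### Inclusion–exclusion at order two and its "strong" form (KS, Cor. 5.2, Lemma 3.8) -/

section InclusionExclusion

variable {ι α : Type*} [DecidableEq α]

/-- The multiplicity of `u` in a finite family of finite sets. [folklore] -/
def mult (s : Finset ι) (W : ι → Finset α) (u : α) : ℕ :=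
  (s.filter fun i => u ∈ W i).card

/-- **Double counting**: `∑_i |W_i| = ∑_{u ∈ ⋃ W_i} d(u)`. [folklore] -/
theorem sum_card_eq_sum_mult (s : Finset ι) (W : ι → Finset α) :
    ∑ i ∈ s, (W i).card = ∑ u ∈ s.biUnion W, mult s W u := by
  unfold mult
  have h1 : ∀ u ∈ s.biUnion W, (s.filter fun i => u ∈ W i).card =
      ∑ i ∈ s, if u ∈ W i then 1 else 0 := fun u _ => by
    rw [Finset.card_eq_sum_ones, Finset.sum_filter]
  rw [Finset.sum_congr rfl h1, Finset.sum_comm]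
  refine Finset.sum_congr rfl fun i hi => ?_
  rw [Finset.sum_ite_mem, Finset.inter_eq_right.2 (Finset.subset_biUnion_of_mem W hi),
    Finset.card_eq_sum_ones]

/-- Every element of the union has positive multiplicity. [folklore] -/
theorem one_le_mult {s : Finset ι} {W : ι → Finset α} {u : α} (hu : u ∈ s.biUnion W) :
    1 ≤ mult s W u := by
  obtain ⟨i, hi, hui⟩ := Finset.mem_biUnion.1 hu
  exact Finset.card_pos.2 ⟨i, Finset.mem_filter.2 ⟨hi, hui⟩⟩

variable [DecidableEq ι]

/-- **Double counting of pairs**: `∑_{i ≠ j} |W_i ∩ W_j| = ∑_{u ∈ ⋃ W_i} d(u) (d(u) - 1)`.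
[folklore] -/
theorem sum_card_inter_eq_sum_mult (s : Finset ι) (W : ι → Finset α) :
    ∑ i ∈ s, ∑ j ∈ s.erase i, (W i ∩ W j).card =
      ∑ u ∈ s.biUnion W, mult s W u * (mult s W u - 1) := by
  -- rewrite `|W_i ∩ W_j|` as a sum over the union
  have step1 : ∀ i ∈ s, ∀ j ∈ s.erase i, (W i ∩ W j).card =
      ∑ u ∈ s.biUnion W, if u ∈ W i ∧ u ∈ W j then 1 else 0 := by
    intro i hi j _
    rw [Finset.card_eq_sum_ones, ← Finset.sum_filter]
    refine Finset.sum_congr ?_ fun _ _ => rfl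
    ext u
    simp only [Finset.mem_inter, Finset.mem_filter, Finset.mem_biUnion]
    constructor
    · rintro ⟨h1, h2⟩; exact ⟨⟨i, hi, h1⟩, h1, h2⟩
    · rintro ⟨-, h1, h2⟩; exact ⟨h1, h2⟩
  rw [Finset.sum_congr rfl fun i hi => Finset.sum_congr rfl (step1 i hi)]
  have swap : ∀ i ∈ s,
      ∑ j ∈ s.erase i, ∑ u ∈ s.biUnion W, (if u ∈ W i ∧ u ∈ W j then 1 else 0) =
        ∑ u ∈ s.biUnion W, ∑ j ∈ s.erase i, (if u ∈ W i ∧ u ∈ W j then 1 else 0) :=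
    fun i _ => Finset.sum_comm
  rw [Finset.sum_congr rfl swap, Finset.sum_comm]
  refine Finset.sum_congr rfl fun u _ => ?_
  -- for fixed `u`: `∑_i ∑_{j ≠ i} [u ∈ W_i][u ∈ W_j] = d (d - 1)`
  have inner : ∀ i ∈ s, ∑ j ∈ s.erase i, (if u ∈ W i ∧ u ∈ W j then 1 else 0) =
      if u ∈ W i then mult s W u - 1 else 0 := by
    intro i hi
    by_cases hui : u ∈ W i
    · rw [if_pos hui]
      simp only [hui, true_and]
      rw [← Finset.sum_filter, ← Finset.card_eq_sum_ones]
      unfold mult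
      rw [Finset.filter_erase, Finset.card_erase_of_mem (Finset.mem_filter.2 ⟨hi, hui⟩)]
    · rw [if_neg hui]
      simp [hui]
  rw [Finset.sum_congr rfl inner, ← Finset.sum_filter, Finset.sum_const, smul_eq_mul]
  rfl

/-- **Kumar–Saraf 2017, Cor. 5.2 (inclusion–exclusion truncated at order two)**:
`∑_i |W_i| ≤ |⋃_i W_i| + ∑_{i ≠ j} |W_i ∩ W_j|` (ordered pairs), i.e.
`|⋃ W_i| ≥ ∑|W_i| - ∑_{i≠j}|W_i ∩ W_j|`; from `d ≤ 1 + d(d-1)` for `d ≥ 1`.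
[cite: KumarSaraf2017, Cor. 5.2] -/
theorem sum_card_le_card_biUnion_add (s : Finset ι) (W : ι → Finset α) :
    ∑ i ∈ s, (W i).card ≤ (s.biUnion W).card + ∑ i ∈ s, ∑ j ∈ s.erase i, (W i ∩ W j).card := by
  rw [sum_card_eq_sum_mult, sum_card_inter_eq_sum_mult, Finset.card_eq_sum_ones,
    ← Finset.sum_add_distrib]
  refine Finset.sum_le_sum fun u hu => ?_
  have h1 := one_le_mult hu
  set d := mult s W u
  have : d - 1 ≤ d * (d - 1) := Nat.le_mul_of_pos_left (d - 1) h1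
  omega

/-- **Kumar–Saraf 2017, Lemma 3.8 (strong inclusion–exclusion), Cauchy–Schwarz form**:
`(∑_i |W_i|)² ≤ |⋃_i W_i| · (∑_i |W_i| + ∑_{i ≠ j} |W_i ∩ W_j|)`, from
`(∑_u d(u))² ≤ |U| ∑_u d(u)²` and `d² = d + d(d-1)`. [cite: KumarSaraf2017, Lemma 3.8] -/
theorem sq_sum_card_le (s : Finset ι) (W : ι → Finset α) :
    (∑ i ∈ s, (W i).card) ^ 2 ≤
      (s.biUnion W).card * (∑ i ∈ s, (W i).card + ∑ i ∈ s, ∑ j ∈ s.erase i, (W i ∩ W j).card) := by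
  rw [sum_card_eq_sum_mult, sum_card_inter_eq_sum_mult, ← Finset.sum_add_distrib]
  refine (sq_sum_le_card_mul_sum_sq (s := s.biUnion W) (f := fun u => mult s W u)).trans ?_
  refine Nat.mul_le_mul_left _ (Finset.sum_le_sum fun u hu => ?_)
  have h1 := one_le_mult hu
  set d := mult s W u
  have : d ^ 2 = d + d * (d - 1) := by
    cases d with
    | zero => omega
    | succ e => rw [Nat.succ_sub_one]; ring
  omega

/-- **Kumar–Saraf 2017, Lemma 3.8, as printed (with the better constant `λ + 1` for `4λ`)**: if
`∑_{i≠j} |W_i ∩ W_j| ≤ λ ∑_i |W_i|` then `∑_i |W_i| ≤ (λ + 1) |⋃_i W_i|`.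
[cite: KumarSaraf2017, Lemma 3.8] -/
theorem card_biUnion_ge_of_sum_inter_le (s : Finset ι) (W : ι → Finset α) (lam : ℕ)
    (h : ∑ i ∈ s, ∑ j ∈ s.erase i, (W i ∩ W j).card ≤ lam * ∑ i ∈ s, (W i).card) :
    ∑ i ∈ s, (W i).card ≤ (lam + 1) * (s.biUnion W).card := by
  have h1 := sq_sum_card_le s W
  set T := ∑ i ∈ s, (W i).card
  set U := (s.biUnion W).card
  rcases Nat.eq_zero_or_pos T with hT | hT
  · rw [hT]; exact Nat.zero_le _
  · have h2 : T ^ 2 ≤ U * ((lam + 1) * T) := h1.trans (Nat.mul_le_mul_left _ (by nlinarith))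
    have h3 : T * T ≤ (lam + 1) * U * T := by nlinarith
    exact Nat.le_of_mul_le_mul_right h3 hT

end InclusionExclusion

end Literature.Computability.AlgebraicComplexity.KumarSaraf

end
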